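import Summits.ResolutionOfSingularities.ResolutionOfSingularities.Theorems.HilbertSamuelEliminationSigmaMaxModificationsCorridor3WLadderStrataLabels
import Summits.ResolutionOfSingularities.ResolutionOfSingularities.Theorems.HilbertSamuelEliminationSigmaMaxModificationsCorridor3MovingCompactnessComposition
import HarnessLib

/-!
# [OURS · L1 W4.2] (N-4) `LabelBoundAlongLineage` — the LABEL BOUND THROUGH THE CHAIN POINTS, typed, and its
# EQUIVALENCE with row (b) `StrataBirthsSettle` (births through the chain points settle), PROVED

Crux chain w42 (`SigmaMaxModifications`, stmt-ResolutionOfSingularities-18506; skeleton `w_ladder` v6 on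
`SigmaMaxModificationsCorridor3`, stmt-ResolutionOfSingularities-19249), W4.2 row list of record (director-resolution
2026-08-27 07:12:58Z (4), res-L1-w42-plan-1 RULINGS v3.9-3 (Q)): «(N-4) `LabelBoundAlongLineage` typing + first scheme-level
lemma». OURS (cell res-hironaka, slot W4.2); NOT statements of H. Hironaka's manuscript [Hironaka2017] nor of
[CossartJannsenSaito2020]; AI-drafted, weaker than expert review. Every `theorem` below is PROVED; the only open content is
the `def … : Prop` rows, which are RESTATEMENTS of row (b) (see §3). Helper file `--supports stmt-ResolutionOfSingularities-19249`.

## What is typed / proved (namespace `…Theorems.SigmaMaxModificationsCorridor3.Moving`)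

* §1 chain-level predicates for a chain `c : ℕ → MarkedStage` of canonical near steps: `LabelsBoundedThrough N ν c` (the CJS
  labels of the components of `X_n(ν)` through `x_n` are bounded along the chain), `NoLateBirthsThrough N ν c` (from some stage
  on no component through `x_{n+1}` is NEWBORN, i.e. carries the new year as its label) and `BirthsSettleThrough R N ν c` (from
  some stage on every component through `x_{n+1}` DOMINATES a component of `X_n(ν)` along the step projection — the matrix of
  row (b) `StrataBirthsSettle`).
* §2 THE SCHEME-LEVEL LEMMAS (label calculus of CJS Rem. 6.29 (1) along the chain, no geometry): `year_eq_add` (the year at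
  stage `n` is `year₀ + n`), `LabelInv.chain`, and the three implications closing the circle
  `LabelsBoundedThrough → NoLateBirthsThrough → BirthsSettleThrough → LabelsBoundedThrough` (the last one under the label
  invariant at stage `0`, which holds on every stage reached from an initial marked stage); hence
  `labelsBoundedThrough_iff_birthsSettleThrough` and `labelsBoundedThrough_iff_noLateBirthsThrough`; and
  `treatedLabel_eventually_const_of_labelsBoundedThrough` (under the label bound the treated label of the resolution cycles met
  by the chain stabilises — tree `treatedLabel_le_of_step` / `treatedLabel_le_label`).
* §3 ROWS: `LabelBoundAlongLineageAt p N Q G` — row (b)'s exact scope with the conclusion «labels through the chain points are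
  bounded» — and `strataBirthsSettle_iff_labelBoundAlongLineageAt : StrataBirthsSettle p N Q G ↔ LabelBoundAlongLineageAt p N Q G`
  (so (N-4) at the scope of (b) IS (b), res-L1-w42-idea-2 r5 «(N-4) ≡ (b) verbatim»); the scope-free form
  `LabelBoundAlongLineage p` of res-L1-w42-idea-1 r5 (Sketch-L1-idea-1-C4 §5: level `3`, every chain of canonical near steps
  from a stage reached from a maximal origin, no grade / isolation / blow-up side conditions), with
  `labelBoundAlongLineageAt_of_labelBoundAlongLineage` and `strataBirthsSettle_of_labelBoundAlongLineage :
  LabelBoundAlongLineage p → StrataBirthsSettle p 3 Q G` for every `Q`, `G`.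

Honest limits: nothing here bounds a label; the file only identifies the two bookkeeping forms of the same open content
(finitely many births through the chain points ⇔ bounded labels through the chain points), so that a τ_bin-type functional
(res-L1-s42-pv-2's certified toric rule, kit j270940) becomes well-founded exactly when row (b) holds on the chain.

References: CJS LNM 2270 Rem. 6.29 (1) pp. 91–92 [CossartJannsenSaito2020]; tree `…Corridor3WLadderStrataLineages` (p500484:
`StepProjection`, `componentsThrough`, `StrataBirthsSettle`), `…Corridor3WLadderStrataLabels` (p503069: `LabelInv`,
`CanonicalNearStep.year_eq` / `.label_cases`, `StepProjection.label_eq_of_mem` / `.mem_componentsIn_of_label_ne`,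
`treatedLabel_le_of_step`), `…Corridor3MovingCompactnessComposition` (`eventually_const_of_monotone_of_bounded`);
HOME/L/w42/CRUX-PLAN.md v3.6 (5)(a); L/res-L1-w42-idea-1/Sketch-L1-idea-1-C4.lean §5; L/res-L1-w42-idea-2 IDEAS r5 (N-4).
-/

noncomputable section

-- plan-1/idea-2 module setting kept (namespace `…Corridor3.Moving` re-enters `…Corridor3`)
set_option linter.dupNamespace false

open CategoryTheory AlgebraicGeometry TopologicalSpace Topology
open Summit.ResolutionOfSingularities.ResolutionOfSingularities.Theorems.CampaignW42
open Literature.AlgebraicGeometry.Resolution Literature.RingTheory.HilbertSamuel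
open Literature.AlgebraicGeometry.CossartJannsenSaito2020
open Summit.ResolutionOfSingularities.ResolutionOfSingularities.Theorems.SigmaMaxModificationsCorridor3

universe u

namespace Summit.ResolutionOfSingularities.ResolutionOfSingularities.Theorems.SigmaMaxModificationsCorridor3.Moving

variable {R : ∀ S : Scheme.{u}, CentreSeq S → Prop} {N : ℕ} {ν : ℕ → ℕ}

/-! ## §1. Chain-level predicates: bounded labels, no late births, births settle -/

/-- [OURS · L1 W4.2 · (N-4)] **LABELS THROUGH THE CHAIN POINTS ARE BOUNDED** along the chain `c`: there is `B` with
`label(Z) ≤ B` for every stage `n` and every irreducible component `Z` of `X_n(ν)` through the marked point `x_n`.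
OURS bookkeeping; NOT a statement of the manuscript. [cite: CossartJannsenSaito2020, Rem. 6.29 (1)] -/
def LabelsBoundedThrough (N : ℕ) (ν : ℕ → ℕ) (c : ℕ → MarkedStage.{u}) : Prop :=
  ∃ B : ℕ, ∀ n, ∀ Z ∈ componentsThrough N ν (c n), (c n).L.label Z ≤ B

/-- [OURS · L1 W4.2 · (N-4)] **NO LATE BIRTHS THROUGH THE CHAIN POINTS**: from some stage `n₁` on, no irreducible component of
`X_{n+1}(ν)` through `x_{n+1}` is NEWBORN — none carries the new year `year(X_n) + 1` as its label («otherwise it gets the label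
`n + 1`»). OURS bookkeeping; NOT a statement of the manuscript. [cite: CossartJannsenSaito2020, Rem. 6.29 (1)] -/
def NoLateBirthsThrough (N : ℕ) (ν : ℕ → ℕ) (c : ℕ → MarkedStage.{u}) : Prop :=
  ∃ n₁ : ℕ, ∀ n, n₁ ≤ n → ∀ Z' ∈ componentsThrough N ν (c (n + 1)), (c (n + 1)).L.label Z' ≠ (c n).L.year + 1

/-- [OURS · L1 W4.2 · (N-4)] **BIRTHS THROUGH THE CHAIN POINTS SETTLE** (the matrix of row (b) `StrataBirthsSettle` for ONE
chain): from some stage `n₁` on, along every step projection `f : X_{n+1} ⟶ X_n` of the chain, every irreducible component `Z'`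
of `X_{n+1}(ν)` through `x_{n+1}` DOMINATES an irreducible component of `X_n(ν)` (`closure f(Z')` is one).
OURS bookkeeping; NOT a statement of the manuscript. [cite: CossartJannsenSaito2020, Rem. 6.29 (1)] -/
def BirthsSettleThrough (R : ∀ S : Scheme.{u}, CentreSeq S → Prop) (N : ℕ) (ν : ℕ → ℕ) (c : ℕ → MarkedStage.{u}) :
    Prop :=
  ∃ n₁ : ℕ, ∀ n, n₁ ≤ n → ∀ f : (c (n + 1)).W ⟶ (c n).W, StepProjection R N ν (c n) (c (n + 1)) f →
    ∀ Z' ∈ componentsThrough N ν (c (n + 1)), closure (f.base '' Z') ∈ componentsIn (Scheme.hsStratum (c n).W N ν)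

/-! ## §2. The scheme-level lemmas: label calculus along a chain of canonical near steps -/

section Chain

variable {c : ℕ → MarkedStage.{u}}

/-- Along a chain of canonical near steps the year at stage `n` is the initial year plus `n`.
[cite: CossartJannsenSaito2020, Rem. 6.29 (1)] -/
theorem year_eq_add (hc : ∀ n, CanonicalNearStep R N ν (c n) (c (n + 1))) (n : ℕ) :
    (c n).L.year = (c 0).L.year + n := by
  induction n with
  | zero => simp
  | succ n ih => rw [(hc n).year_eq, ih, Nat.add_assoc]

/-- Hence `n ≤ year(X_n)`. [folklore] -/
theorem le_year (hc : ∀ n, CanonicalNearStep R N ν (c n) (c (n + 1))) (n : ℕ) : n ≤ (c n).L.year := by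
  rw [year_eq_add hc n]
  exact Nat.le_add_left n _

/-- The year is monotone along the chain. [folklore] -/
theorem year_mono (hc : ∀ n, CanonicalNearStep R N ν (c n) (c (n + 1))) {m n : ℕ} (hmn : m ≤ n) :
    (c m).L.year ≤ (c n).L.year := by
  rw [year_eq_add hc m, year_eq_add hc n]
  exact Nat.add_le_add_left hmn _

/-- The stages of the chain are reached from its first stage. [folklore] -/
theorem reaches_of_chain (hc : ∀ n, CanonicalNearStep R N ν (c n) (c (n + 1))) (n : ℕ) : Reaches R N ν (c 0) (c n) := by
  induction n with
  | zero => exact Relation.ReflTransGen.refl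
  | succ n ih => exact Relation.ReflTransGen.tail ih (hc n)

/-- The label invariant propagates along the chain. [cite: CossartJannsenSaito2020, Rem. 6.29 (1)] -/
theorem LabelInv.chain (h0 : LabelInv N ν (c 0)) (hc : ∀ n, CanonicalNearStep R N ν (c n) (c (n + 1))) (n : ℕ) :
    LabelInv N ν (c n) :=
  h0.of_reaches (reaches_of_chain hc n)

/-- **BOUNDED LABELS ⇒ NO LATE BIRTHS**: once the year exceeds the bound, no component through the chain point can carry the
new year as its label. [cite: CossartJannsenSaito2020, Rem. 6.29 (1)] -/
theorem noLateBirthsThrough_of_labelsBoundedThrough (hc : ∀ n, CanonicalNearStep R N ν (c n) (c (n + 1)))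
    (hB : LabelsBoundedThrough N ν c) : NoLateBirthsThrough N ν c := by
  obtain ⟨B, hB⟩ := hB
  refine ⟨B, fun n hn Z' hZ' h => ?_⟩
  have h1 := hB (n + 1) Z' hZ'
  have h2 := le_year hc n
  omega

/-- **NO LATE BIRTHS ⇒ BIRTHS SETTLE**: a component whose label is not the new year dominates a component of the previous
stratum («otherwise it gets the label `n + 1`», contrapositive, tree `StepProjection.mem_componentsIn_of_label_ne`).
[cite: CossartJannsenSaito2020, Rem. 6.29 (1)] -/
theorem birthsSettleThrough_of_noLateBirthsThrough (h : NoLateBirthsThrough N ν c) : BirthsSettleThrough R N ν c := by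
  obtain ⟨n₁, h⟩ := h
  exact ⟨n₁, fun n hn f hf Z' hZ' => hf.mem_componentsIn_of_label_ne (h n hn Z' hZ')⟩

/-- **BIRTHS SETTLE ⇒ BOUNDED LABELS** (under the label invariant at the first stage): past the settling stage `n₁` every
component through `x_{n+1}` inherits the label of a component through `x_n` («dominates ⇒ inherits», tree
`StepProjection.label_eq_of_mem`, and domination continues the lineage through the chain points,
`closure_image_mem_componentsThrough`), so by induction every label met from `n₁` on is a label met at `n₁`;
all labels up to stage `n₁` are `≤ year(X_{n₁})` (labels `≤` year, years increase). Bound: `B = year(X_{n₁})`.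
[cite: CossartJannsenSaito2020, Rem. 6.29 (1)] -/
theorem labelsBoundedThrough_of_birthsSettleThrough (h0 : LabelInv N ν (c 0))
    (hc : ∀ n, CanonicalNearStep R N ν (c n) (c (n + 1))) (hb : BirthsSettleThrough R N ν c) :
    LabelsBoundedThrough N ν c := by
  obtain ⟨n₁, hb⟩ := hb
  refine ⟨(c n₁).L.year, fun n => ?_⟩
  by_cases hn : n ≤ n₁
  · intro Z _
    exact ((LabelInv.chain h0 hc n).label_le_year Z).trans (year_mono hc hn)
  · -- `n = n₁ + k`, induction on `k`
    obtain ⟨k, rfl⟩ : ∃ k, n = n₁ + k := ⟨n - n₁, by omega⟩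
    clear hn
    induction k with
    | zero =>
      intro Z _
      exact (LabelInv.chain h0 hc n₁).label_le_year Z
    | succ k ih =>
      -- `n₁ + (k + 1)` is definitionally `n₁ + k + 1`
      intro (Z' : Set (c (n₁ + k + 1)).W) (hZ' : Z' ∈ componentsThrough N ν (c (n₁ + k + 1)))
      show (c (n₁ + k + 1)).L.label Z' ≤ (c n₁).L.year
      obtain ⟨f, hf⟩ := (hc (n₁ + k)).exists_stepProjection
      have hdom := hb (n₁ + k) (Nat.le_add_right _ _) f hf Z' hZ'
      rw [hf.label_eq_of_mem hdom]
      exact ih _ (closure_image_mem_componentsThrough hf hZ' hdom)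

/-- **(N-4) ON ONE CHAIN ⇔ ROW (b) ON ONE CHAIN** (under the label invariant at the first stage).
[cite: CossartJannsenSaito2020, Rem. 6.29 (1)] -/
theorem labelsBoundedThrough_iff_birthsSettleThrough (h0 : LabelInv N ν (c 0))
    (hc : ∀ n, CanonicalNearStep R N ν (c n) (c (n + 1))) :
    LabelsBoundedThrough N ν c ↔ BirthsSettleThrough R N ν c :=
  ⟨fun h => birthsSettleThrough_of_noLateBirthsThrough (noLateBirthsThrough_of_labelsBoundedThrough hc h),
    labelsBoundedThrough_of_birthsSettleThrough h0 hc⟩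

/-- **BOUNDED LABELS ⇔ NO LATE BIRTHS** on one chain (under the label invariant at the first stage).
[cite: CossartJannsenSaito2020, Rem. 6.29 (1)] -/
theorem labelsBoundedThrough_iff_noLateBirthsThrough (h0 : LabelInv N ν (c 0))
    (hc : ∀ n, CanonicalNearStep R N ν (c n) (c (n + 1))) :
    LabelsBoundedThrough N ν c ↔ NoLateBirthsThrough N ν c :=
  ⟨noLateBirthsThrough_of_labelsBoundedThrough hc, fun h =>
    labelsBoundedThrough_of_birthsSettleThrough h0 hc (birthsSettleThrough_of_noLateBirthsThrough (R := R) h)⟩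

/-- Along a chain of canonical near steps the marked point of every later stage lies in the `ν`-stratum. [folklore] -/
theorem pt_succ_mem_hsStratum (hc : ∀ n, CanonicalNearStep R N ν (c n) (c (n + 1))) (n : ℕ) :
    (c (n + 1)).pt ∈ Scheme.hsStratum (c (n + 1)).W N ν := by
  obtain ⟨f, hf⟩ := (hc n).exists_stepProjection
  exact hf.pt_mem_hsStratum

/-- **BOUNDED LABELS ⇒ THE TREATED LABEL STABILISES**: under (N-4) on a chain (and the label invariant at its first stage)
the treated label — non-decreasing along canonical near steps (tree `treatedLabel_le_of_step`) and bounded by the label of any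
component through the chain point (tree `treatedLabel_le_label`) — is EVENTUALLY CONSTANT: from some stage on every resolution
cycle met by the chain treats the same label `j` (the bookkeeping input «the least treated label is eventually constant» of the
intended proof of row (c), here obtained from the label bound instead of from an infinite lineage).
[cite: CossartJannsenSaito2020, Rem. 6.29 (1), proof of Thm. 6.28 Step 7] -/
theorem treatedLabel_eventually_const_of_labelsBoundedThrough (h0 : LabelInv N ν (c 0))
    (hc : ∀ n, CanonicalNearStep R N ν (c n) (c (n + 1))) (hB : LabelsBoundedThrough N ν c) :
    ∃ j n₀, ∀ n, n₀ ≤ n → treatedLabel N ν (c n) = j := by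
  obtain ⟨B, hB⟩ := hB
  have hne : ∀ n, (Scheme.hsStratum (c (n + 1)).W N ν).Nonempty := fun n => ⟨_, pt_succ_mem_hsStratum hc n⟩
  have hsucc : ∀ n, treatedLabel N ν (c n) ≤ treatedLabel N ν (c (n + 1)) := fun n =>
    treatedLabel_le_of_step (LabelInv.chain h0 hc n) (hc n) (hne n)
  refine
    Summit.ResolutionOfSingularities.ResolutionOfSingularities.Cruxes.SigmaMaxModifications.MovingCompactnessLine.eventually_const_of_monotone_of_bounded
      (monotone_nat_of_le_succ hsucc) (B := B) fun n => (hsucc n).trans ?_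
  obtain ⟨Z, hZ⟩ := componentsThrough_nonempty (N := N) (ν := ν) (pt_succ_mem_hsStratum hc n)
  exact (treatedLabel_le_label (LabelInv.chain h0 hc (n + 1)) hZ.1).trans (hB (n + 1) Z hZ)

/-- The label invariant holds at the first stage of a chain starting at a stage reached from an initial marked stage.
[cite: CossartJannsenSaito2020, Rem. 6.29 (1)] -/
theorem labelInv_of_reaches_init {X : Scheme.{u}} [IsLocallyNoetherian X] {x : X} {s : MarkedStage.{u}}
    (hr : Reaches R N ν (MarkedStage.init X x) s) : LabelInv N ν s :=
  (labelInv_init X x).of_reaches hr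

end Chain

/-! ## §3. The rows: (N-4) at the scope of row (b), the equivalence, and idea-1's scope-free form -/

/-- [OURS · L1 W4.2 · (N-4)] **ROW (N-4) AT THE SCOPE OF ROW (b) — LABELS THROUGH THE CHAIN POINTS ARE BOUNDED.** For every
functional admissible oracle, value `ν`, maximal origin `x ∈ X(ν)` of characteristic `p` at level `N` satisfying `Q`, and every
MOVING chain of canonical near steps `x_n ∈ X_n(ν)` from it inside the grade `G` which is NEVER isolated in `(X_n)_max` and is
blown up at infinitely many stages: the CJS labels (years of birth) of the irreducible components of `X_n(ν)` through `x_n` are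
BOUNDED along the chain (⇔ only finitely many labels are met; ⇔ row (b), `strataBirthsSettle_iff_labelBoundAlongLineageAt`).
TORIC INSTANCE: res-L1-s42-pv-2's certified END/ARRANGEMENT epoch bounds on `y^m + x^A` (kit j270940), under which `τ_bin`
strictly decreases on every genuine `ē = 3` edge of the j270062 lineage set. OURS row, OPEN (it is row (b) restated); NOT a
statement of the manuscript. [cite: CossartJannsenSaito2020, Rem. 6.29 (1)] -/
def LabelBoundAlongLineageAt (p N : ℕ) (Q : ℕ → (ℕ → ℕ) → ∀ X : Scheme.{u}, X → Prop) (G : MarkedStage.{u} → Prop) :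
    Prop :=
  ∀ (R : ∀ S : Scheme.{u}, CentreSeq S → Prop), OracleFunctional R → OracleAdmissible R →
  ∀ (ν : ℕ → ℕ) (X : Scheme.{u}) [IsLocallyNoetherian X] (x : X), IsMaximalOrigin p N ν X x → Q N ν X x →
  ∀ c : ℕ → MarkedStage.{u}, Reaches R N ν (MarkedStage.init X x) (c 0) →
    (∀ n, CanonicalNearStep R N ν (c n) (c (n + 1))) → (∀ n, G (c n)) → (∀ n, ¬ Iso N (c n)) →
    (∀ n, ∃ m, n ≤ m ∧ (c m).IsBlownUp R N ν) →
    ∃ B : ℕ, ∀ n, ∀ Z ∈ componentsThrough N ν (c n), (c n).L.label Z ≤ B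

/-- **ROW (b) ⇔ ROW (N-4) AT THE SAME SCOPE** — PROVED: «births through the chain points settle» and «labels through the chain
points are bounded» are the same statement, chain by chain (§2). [cite: CossartJannsenSaito2020, Rem. 6.29 (1)] -/
theorem strataBirthsSettle_iff_labelBoundAlongLineageAt {p N : ℕ} {Q : ℕ → (ℕ → ℕ) → ∀ X : Scheme.{u}, X → Prop}
    {G : MarkedStage.{u} → Prop} : StrataBirthsSettle p N Q G ↔ LabelBoundAlongLineageAt p N Q G := by
  constructor
  · intro h R hRf hRa ν X _ x hx hQ c hc0 hc hG hni hio
    exact labelsBoundedThrough_of_birthsSettleThrough (labelInv_of_reaches_init hc0) hc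
      (h R hRf hRa ν X x hx hQ c hc0 hc hG hni hio)
  · intro h R hRf hRa ν X _ x hx hQ c hc0 hc hG hni hio
    exact (labelsBoundedThrough_iff_birthsSettleThrough (labelInv_of_reaches_init hc0) hc).mp
      (h R hRf hRa ν X x hx hQ c hc0 hc hG hni hio)

/-- [OURS · L1 W4.2 · (N-4)] **LABELS MET ALONG ONE LINEAGE ARE BOUNDED** — res-L1-w42-idea-1's scope-free form (round 5,
Sketch-L1-idea-1-C4 §5, verbatim up to the name of the bound variable): along a chain of canonical near steps from (a stage
reached from) a level-`3` maximal origin of characteristic `p`, the CJS labels of the `ν`-stratum components passing through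
the tracked point are bounded (⇔ only finitely many distinct labels are ever met — labels are years of birth). No grade, no
isolation and no blow-up side condition: it implies row (b) at level `3` for EVERY `Q`, `G`
(`strataBirthsSettle_of_labelBoundAlongLineage`). CAUTION (idea-1 r5): on an ISOLATED point tower every stratum component
through `pt_{n+1}` is NEWBORN, so restricted to iso lineages this is as strong as `IsoQuadraticTowerTerminates p 3` — it is NOT
a soft lemma. OURS row, OPEN; NOT a statement of any manuscript. [cite: CossartJannsenSaito2020, Rem. 6.29 (1)] -/
def LabelBoundAlongLineage (p : ℕ) : Prop :=
  ∀ (R : ∀ S : Scheme.{u}, CentreSeq S → Prop), OracleFunctional R → OracleAdmissible R →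
  ∀ (ν : ℕ → ℕ) (X : Scheme.{u}) [IsLocallyNoetherian X] (x : X), IsMaximalOrigin p 3 ν X x →
  ∀ c : ℕ → MarkedStage.{u}, Reaches R 3 ν (MarkedStage.init X x) (c 0) →
    (∀ n, CanonicalNearStep R 3 ν (c n) (c (n + 1))) →
    ∃ B : ℕ, ∀ n, ∀ Z ∈ componentsIn (Scheme.hsStratum (c n).W 3 ν), (c n).pt ∈ Z → (c n).L.label Z ≤ B

/-- The scope-free form gives the scoped row at level `3` for every origin predicate and grade. [folklore] -/
theorem labelBoundAlongLineageAt_of_labelBoundAlongLineage {p : ℕ} (h : LabelBoundAlongLineage.{u} p)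
    (Q : ℕ → (ℕ → ℕ) → ∀ X : Scheme.{u}, X → Prop) (G : MarkedStage.{u} → Prop) : LabelBoundAlongLineageAt p 3 Q G := by
  intro R hRf hRa ν X _ x hx _ c hc0 hc _ _ _
  obtain ⟨B, hB⟩ := h R hRf hRa ν X x hx c hc0 hc
  exact ⟨B, fun n Z hZ => hB n Z hZ.1 hZ.2⟩

/-- **(N-4), scope-free ⇒ ROW (b) at level `3`** for every origin predicate `Q` and grade `G` — PROVED.
[cite: CossartJannsenSaito2020, Rem. 6.29 (1)] -/
theorem strataBirthsSettle_of_labelBoundAlongLineage {p : ℕ} (h : LabelBoundAlongLineage.{u} p)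
    (Q : ℕ → (ℕ → ℕ) → ∀ X : Scheme.{u}, X → Prop) (G : MarkedStage.{u} → Prop) : StrataBirthsSettle p 3 Q G :=
  strataBirthsSettle_iff_labelBoundAlongLineageAt.mpr (labelBoundAlongLineageAt_of_labelBoundAlongLineage h Q G)

end Summit.ResolutionOfSingularities.ResolutionOfSingularities.Theorems.SigmaMaxModificationsCorridor3.Moving
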